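import Literature.Computability.Complexity.PromiseZPP
import Literature.Computability.Complexity.TM2Iterate
import Literature.Computability.MetaComplexity.GapMINKTAverageCase
import Literature.Computability.MetaComplexity.GapMINKTDenseRandom
import HarnessLib

/-!
# Complexity meta: certificates, the search version of `Gap MINKT`, and Hirahara's Theorem 4.21

Topic `Literature/Computability/MetaComplexity`. Third file of the decomposition of the named fact
`Hirahara2018_gapMINKT_mem_PromiseP` (`GapMINKT.lean`; Hirahara, FOCS 2018 / ECCC TR18-138 rev. 1,
Cor. 4.23). `GapMINKTAverageCase.lean` vendors Cor. 4.22 (1 ⇒ 4) and `GapMINKTDenseRandom.lean`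
its first step (1 ⇒ 2) with Lemma 4.17; this file vendors the remaining two printed steps,
(2 ⇒ 3) = **Theorem 4.21** (the main theorem: a zero-error randomised polynomial-time algorithm for
the *search version* of `Gap_{σ,τ}MINKT`) and (3 ⇒ 4) = **Fact 3.8** (decision reduces to search),
and PROVES the glue `Cor. 4.22 (1 ⇒ 4)` from (1 ⇒ 2), Thm. 4.21 and Fact 3.8.

Definitions (real), for `U : UniversalMachine`:

* `U.IsCertificate t s x d` — `d` is a *certificate for `K^t(x) ≤ s`*: `U(d)` outputs `x` within `t`
  steps and `|d| ≤ s` (Def. 3.5); basic API (`ktAt_le`, `mono`, existence iff `K^t(x) ≤ s`).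
* `U.SolvesGapMINKTSearch σ τ A` — `A` is a *zero-error randomised polynomial-time algorithm solving
  the search version of `Gap_{σ,τ}MINKT`* (Def. 3.7): a probabilistic polynomial-time
  `A : RandAlg (List Bool × ℕ) (Option (List Bool))` on inputs `(x, 1^t)` (encoded by `paramEnc`),
  with a polynomial coin budget, that outputs `⊥ = none` with probability `≤ 1/2` and otherwise a
  certificate for `K^{τ(|x|,t)}(x) ≤ σ(|x|, K^t(x))`.
* `IsPolyTimeUnary₂ f` — "efficiently computable" parameter functions `f : ℕ → ℕ → ℕ`: polynomial
  time with unary input `⟨1^n, 1^s⟩` and unary output (Fact 3.8's hypothesis); `sigmaBound c`, the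
  explicit threshold `s + c·(log₂ n·⌊√s⌋ + (log₂ n)² + 1)` of the tree's rendering of
  "`σ(n,s) = s + O((log n)√s + (log n)²)`".

Named facts (statements only, `def … : Prop`, D-0014):

* `Hirahara2018_gapMINKTSearch_of_AvgDeltaP` — **Thm. 4.21**;
* `Hirahara2018_gapMINKT_mem_PromiseZPP_of_search` — **Fact 3.8**.

Proved: `SolvesGapMINKTSearch.mono` (a search algorithm for `(σ,τ)` is one for any pointwise larger
`(σ',τ')`, `run_mono`), monotonicity of `sigmaBound`, and the glue
`Hirahara2018_gapMINKT_mem_PromiseZPP_of` : (1 ⇒ 2) → Thm. 4.21 → Fact 3.8 → (polynomial-time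
computability of the explicit bounds `sigmaBound c` and `(n,t) ↦ p(n+t)`, two machine lemmas left as
hypotheses) → `Hirahara2018_gapMINKT_mem_PromiseZPP`.

## Design choices and faithfulness

* **`K^t(x) = ⊤`.** Def. 3.7 asks for a certificate for `K^{t'}(x) ≤ σ(|x|, K^t(x))`; when no
  program prints `x` within `t` steps (`K^t(x) = ⊤`, possible for small `t`) the length bound is
  void and we still require the output to print `x` within `τ(|x|,t)` steps (the reading under which
  Fact 3.8's proof — "accept iff `|d| ≤ σ(|x|,s)` and `U(d)` outputs `x` in `τ(|x|,t)` steps" — is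
  literally correct; on such inputs every `(x,1^t,1^s)` is outside the yes-promise anyway).
* **Coins.** As everywhere in the tree (`RandAlg`, `Randomized.lean`) the behaviour of `A` is
  constrained on coin strings of the prescribed length `coinLen |⟨x,1^t⟩|` only (those sampled by
  `outputPMF`), and — as in the machine forms `mem_BPP_iff_randAlg` / `mem_ZPP_iff_expectedTime`
  of `ProbabilisticClasses.lean` — the coin budget is an exact polynomial (a probabilistic Turing
  machine tosses `p(|x|)` coins; a non-computable budget read off `|r|` is not a machine, and the
  decision procedure of Fact 3.8 has to cut the coins of `A` out of its own);
  "for any `t' ≥ τ(|x|,t)`" of Def. 3.7 is the case `t' = τ(|x|,t)` by `run_mono`.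
* **Fact 3.8's hypotheses** "`σ, τ` efficiently computable and nondecreasing" are rendered in the
  strongest reading (polynomial time with unary input/output — which also forces polynomial growth —
  and monotone in each argument), so the vendored fact is implied by the printed one. Thm. 4.21 does
  not assert these properties of its `σ, τ`; the glue therefore passes to the explicit pointwise
  larger bounds `sigmaBound c ≥ σ`, `p(n+t) ≥ τ(n,t)` (`SolvesGapMINKTSearch.mono`), which are
  monotone (proved) and polynomial-time computable (hypotheses `hσ`, `hτ` of the glue: routine
  unary-arithmetic machines, not vendored as facts).
* Thm. 4.21's hypothesis "`n - c√n log n ≤ r(n) < n` for all large `n`" is rendered over `ℕ` as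
  `n ≤ r n + c·⌊√n⌋·⌊log₂ n⌋ ∧ r n < n` (equivalent up to the constant `c`).

## References

* S. Hirahara, *Non-black-box worst-case to average-case reductions within NP*, FOCS 2018; full
  version ECCC TR18-138 rev. 1 (2019): Def. 3.5 (certificate), Def. 3.7 (search version), Fact 3.8,
  Thm. 4.21, Cor. 4.22 [Hirahara2018] (text checked: ECCC revision 1 PDF).
* J. Gill, *Computational complexity of probabilistic Turing machines*, SIAM J. Comput. 6 (1977)
  (zero-error algorithms, `ZPP = RP ∩ coRP`).
-/

namespace Literature.Computability.MetaComplexity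

open _root_.Computability Complexity

/-! ### Certificates (Def. 3.5) -/

namespace UniversalMachine

variable (U : UniversalMachine)

/-- **Certificate** (Def. 3.5): `d` is a certificate for `K^t(x) ≤ s` if `U(d)` outputs `x` within
`t` steps and `|d| ≤ s`. [cite: Hirahara2018, Def. 3.5] -/
def IsCertificate (t s : ℕ) (x d : List Bool) : Prop :=
  U.run d t = some x ∧ d.length ≤ s

/-- A certificate for `K^t(x) ≤ s` witnesses `K^t(x) ≤ s`. [cite: Hirahara2018, Def. 3.5] -/
theorem IsCertificate.ktAt_le {t s : ℕ} {x d : List Bool} (h : U.IsCertificate t s x d) :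
    U.ktAt t x ≤ s :=
  (U.ktAt_le_length h.1).trans (by exact_mod_cast h.2)

/-- Certificates persist when the time bound or the length bound is enlarged (`run_mono`).
[cite: Hirahara2018, Def. 3.5] -/
theorem IsCertificate.mono {t t' s s' : ℕ} {x d : List Bool} (ht : t ≤ t') (hs : s ≤ s')
    (h : U.IsCertificate t s x d) : U.IsCertificate t' s' x d :=
  ⟨U.run_mono ht h.1, h.2.trans hs⟩

/-- `K^t(x) ≤ s` iff some certificate for it exists (the infimum defining `K^t` is attained).
[cite: Hirahara2018, Def. 3.5] -/
theorem exists_isCertificate_iff {t s : ℕ} {x : List Bool} :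
    (∃ d, U.IsCertificate t s x d) ↔ U.ktAt t x ≤ s := by
  constructor
  · rintro ⟨d, hd⟩
    exact hd.ktAt_le
  · intro h
    have h' : U.ktAt t x < (s + 1 : ℕ) := lt_of_le_of_lt h (by exact_mod_cast Nat.lt_succ_self s)
    obtain ⟨d, hrun, hlen⟩ := U.exists_run_eq_of_ktAt_lt h'
    exact ⟨d, hrun, Nat.lt_succ_iff.1 (by exact_mod_cast hlen)⟩

/-! ### The search version of `Gap_{σ,τ} MINKT` (Def. 3.7) -/

/-- **Zero-error randomised polynomial-time algorithm solving the search version of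
`Gap_{σ,τ}MINKT`** (Def. 3.7). `A` is a probabilistic polynomial-time algorithm (tree `RandAlg`, input
`(x, 1^t)` encoded by `paramEnc`, output `Option (List Bool)` with `none = ⊥`) such that for every
`x` and `t`: (i) whenever `A(x, 1^t)` outputs some `d` (on coins of the prescribed length), `U(d)`
outputs `x` within `τ(|x|, t)` steps and `|d| ≤ σ(|x|, K^t(x))` (a certificate for
`K^{t'}(x) ≤ σ(|x|, K^t(x))` for every `t' ≥ τ(|x|,t)`, by `run_mono`; the length bound is void when
`K^t(x) = ⊤`), and (ii) `A(x, 1^t) = ⊥` with probability at most `1/2`. As in the tree's machine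
forms of `BPP`/`ZPP` (`mem_BPP_iff_randAlg`, `ProbabilisticClasses.lean`; Arora–Barak 2009, Def. 7.3:
"`p(|x|)` random bits") the coin budget is *literally a polynomial* `q` — a merely polynomially
bounded, possibly non-computable `coinLen` read off `|r|` would not be a probabilistic Turing
machine. [cite: Hirahara2018, Def. 3.7] -/
def SolvesGapMINKTSearch (σ τ : ℕ → ℕ → ℕ) (A : RandAlg (List Bool × ℕ) (Option (List Bool))) :
    Prop :=
  A.IsPolyTime paramEnc ((encodingList Bool).optionBool).encode ∧
    (∃ q : Polynomial ℕ, ∀ n, A.coinLen n = q.eval n) ∧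
    ∀ (x : List Bool) (t : ℕ),
      (∀ r : List Bool, r.length = A.coinLen (paramEnc (x, t)).length →
        ∀ d : List Bool, A.run (x, t) r = some d →
          U.run d (τ x.length t) = some x ∧ ∀ k : ℕ, U.ktAt t x = k → d.length ≤ σ x.length k) ∧
      A.pr paramEnc (x, t) {o | o = none} ≤ 1 / 2

/-- A zero-error search algorithm for `Gap_{σ,τ}MINKT` is one for `Gap_{σ',τ'}MINKT` whenever
`σ ≤ σ'` and `τ ≤ τ'` pointwise (a certificate stays a certificate, `run_mono`).
[cite: Hirahara2018, Def. 3.7] -/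
theorem SolvesGapMINKTSearch.mono {σ σ' τ τ' : ℕ → ℕ → ℕ}
    {A : RandAlg (List Bool × ℕ) (Option (List Bool))} (hσ : ∀ n s, σ n s ≤ σ' n s)
    (hτ : ∀ n t, τ n t ≤ τ' n t) (h : U.SolvesGapMINKTSearch σ τ A) :
    U.SolvesGapMINKTSearch σ' τ' A := by
  refine ⟨h.1, h.2.1, fun x t => ⟨fun r hr d hd => ?_, (h.2.2 x t).2⟩⟩
  obtain ⟨hrun, hlen⟩ := (h.2.2 x t).1 r hr d hd
  exact ⟨U.run_mono (hτ _ _) hrun, fun k hk => (hlen k hk).trans (hσ _ _)⟩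

/-- On inputs with `K^t(x) ≤ s`, a non-`⊥` output of a search algorithm is a certificate for
`K^{τ(|x|,t)}(x) ≤ σ(|x|, s)` as soon as `σ(|x|, ·)` is nondecreasing — the yes-case of Fact 3.8.
[cite: Hirahara2018, Fact 3.8 (proof)] -/
theorem SolvesGapMINKTSearch.isCertificate_of_ktAt_le {σ τ : ℕ → ℕ → ℕ}
    {A : RandAlg (List Bool × ℕ) (Option (List Bool))} (h : U.SolvesGapMINKTSearch σ τ A)
    (hσ : ∀ n, Monotone (σ n)) {x : List Bool} {t s : ℕ} (hk : U.ktAt t x ≤ s) {r d : List Bool}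
    (hr : r.length = A.coinLen (paramEnc (x, t)).length) (hd : A.run (x, t) r = some d) :
    U.IsCertificate (τ x.length t) (σ x.length s) x d := by
  obtain ⟨hrun, hlen⟩ := (h.2.2 x t).1 r hr d hd
  have hfin : U.ktAt t x ≠ ⊤ := ne_top_of_le_ne_top (ENat.coe_ne_top s) hk
  obtain ⟨k, hk'⟩ := ENat.ne_top_iff_exists.1 hfin
  refine ⟨hrun, (hlen k hk'.symm).trans (hσ _ ?_)⟩
  have hks : (k : ℕ∞) ≤ s := by rw [hk']; exact hk
  exact_mod_cast hks

end UniversalMachine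

/-! ### Efficiently computable parameter functions and the explicit threshold -/

/-- "Efficiently computable" two-argument parameter functions (Fact 3.8): `f : ℕ → ℕ → ℕ` is
computable in polynomial time from the unary inputs `⟨1^n, 1^s⟩` with unary output (which forces
`f(n,s) ≤ poly(n+s)`, true of all parameter functions in Hirahara's statements).
[cite: Hirahara2018, Fact 3.8] -/
def IsPolyTimeUnary₂ (f : ℕ → ℕ → ℕ) : Prop :=
  PolyTimeComputable (fun p : ℕ × ℕ => boolPair (unaryEncodeNat p.1) (unaryEncodeNat p.2))
    unaryEncodeNat (Function.uncurry f)

/-- The explicit threshold `sigmaBound c n s = s + c·(log₂ n·⌊√s⌋ + (log₂ n)² + 1)`, the tree's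
rendering of "`σ(n,s) = s + O((log n)√s + (log n)²)`" (`Hirahara2018_gapMINKT_mem_PromiseP`).
[cite: Hirahara2018, Thm. 4.21] -/
def sigmaBound (c : ℕ) (n s : ℕ) : ℕ :=
  s + c * (Nat.log 2 n * Nat.sqrt s + Nat.log 2 n ^ 2 + 1)

/-- `sigmaBound c n` is nondecreasing in `s` (`Nat.sqrt` is monotone). [folklore] -/
theorem monotone_sigmaBound_right (c n : ℕ) : Monotone (sigmaBound c n) := fun s s' h => by
  unfold sigmaBound
  have hs : Nat.sqrt s ≤ Nat.sqrt s' := Nat.sqrt_le_sqrt h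
  gcongr

/-- `sigmaBound c · s` is nondecreasing in `n` (`Nat.log 2` is monotone). [folklore] -/
theorem monotone_sigmaBound_left (c s : ℕ) : Monotone fun n => sigmaBound c n s := fun n n' h => by
  show sigmaBound c n s ≤ sigmaBound c n' s
  unfold sigmaBound
  have hl : Nat.log 2 n ≤ Nat.log 2 n' := Nat.log_mono_right h
  have h1 : Nat.log 2 n * Nat.sqrt s ≤ Nat.log 2 n' * Nat.sqrt s := Nat.mul_le_mul_right _ hl
  have h2 : Nat.log 2 n ^ 2 ≤ Nat.log 2 n' ^ 2 := Nat.pow_le_pow_left hl 2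
  have h3 : c * (Nat.log 2 n * Nat.sqrt s + Nat.log 2 n ^ 2 + 1) ≤
      c * (Nat.log 2 n' * Nat.sqrt s + Nat.log 2 n' ^ 2 + 1) := Nat.mul_le_mul_left _ (by omega)
  omega

/-! ### Named facts: Theorem 4.21 and Fact 3.8 -/

/-- **Hirahara 2018, Theorem 4.21 (Main).** *Let `r : ℕ → ℕ` be any function such that for some
constant `c > 0`, for all large `n`, `n - c√n log n ≤ r(n) < n`. Assume that
`(MINKT[r], 𝒟^KT) ∈ Avg_{1/6m}P`. Then, for some function `σ(n,s) = s + O((log n)√s + (log n)²)` and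
some polynomial `τ`, there exists a zero-error randomized polynomial-time algorithm solving the search
version of `Gap_{σ,τ}MINKT`.* Rendering: the hypothesis on `r` over `ℕ` (`n ≤ r n + c⌊√n⌋⌊log₂ n⌋`),
`Avg_δP = AvgDeltaP`, `MINKT[r] = U.MINKTr r`, `𝒟^KT = DKT` (`GapMINKTDenseRandom.lean`), the parameter
shape exactly as in `Hirahara2018_gapMINKT_mem_PromiseP`, the search version as
`U.SolvesGapMINKTSearch` (Def. 3.7). The printed proof: Lemma 4.17 (dense `T ∈ P` inside `R_t[r]`),
Cor. 4.12 (Nisan–Wigderson reconstruction with a list-decodable code relative to the oracle `T_{t₁}`,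
advice `≈ K_t(x) + O(ℓ√K_t(x)) + ℓ²`), Lemma 4.19 and Lemma 3.9 (removing the `P` oracle), Lemma 4.20
(zero error from a Kolmogorov-random string). [cite: Hirahara2018, Thm. 4.21] -/
def Hirahara2018_gapMINKTSearch_of_AvgDeltaP : Prop :=
  ∀ (U : UniversalMachine) (r : ℕ → ℕ) (c : ℕ),
    (∃ n₀, ∀ n ≥ n₀, n ≤ r n + c * (Nat.sqrt n * Nat.log 2 n) ∧ r n < n) →
    (⟨U.MINKTr r, DKT⟩ : DistProblem) ∈ AvgDeltaP (fun m => 1 / (6 * m)) →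
      ∃ (σ τ : ℕ → ℕ → ℕ) (c' : ℕ) (p : Polynomial ℕ),
        (∀ n s, s ≤ σ n s ∧ σ n s ≤ s + c' * (Nat.log 2 n * Nat.sqrt s + Nat.log 2 n ^ 2 + 1)) ∧
        (∀ n t, t ≤ τ n t ∧ τ n t ≤ p.eval (n + t)) ∧
        ∃ A : RandAlg (List Bool × ℕ) (Option (List Bool)), U.SolvesGapMINKTSearch σ τ A

/-- **Hirahara 2018, Fact 3.8 (decision reduces to search).** *Let `σ, τ : ℕ × ℕ → ℕ` be any
efficiently computable and nondecreasing functions. If there exists a zero-error randomized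
polynomial-time algorithm solving the search version of `Gap_{σ,τ}MINKT`, then
`Gap_{σ,τ}MINKT ∈ Promise-ZPP`.* Rendering: Def. 3.6's standing conditions `s ≤ σ(n,s)`,
`t ≤ τ(n,t)` ("functions `σ, τ` as in Definition 3.6"), `IsPolyTimeUnary₂` for "efficiently
computable", monotone in each argument for "nondecreasing", `Promise-ZPP = PromiseZPP'`. The printed proof: on
`(x,1^t,1^s)` run the search algorithm on `(x,1^t)`; on `⊥` answer `⊥`, otherwise accept iff the
output `d` has `|d| ≤ σ(|x|,s)` and `U(d)` prints `x` within `τ(|x|,t)` steps (a yes-instance yields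
a certificate for `K^{t'}(x) ≤ σ(|x|,K^t(x)) ≤ σ(|x|,s)`; on a no-instance no such `d` exists).
[cite: Hirahara2018, Fact 3.8] -/
def Hirahara2018_gapMINKT_mem_PromiseZPP_of_search : Prop :=
  ∀ (U : UniversalMachine) (σ τ : ℕ → ℕ → ℕ),
    (∀ n s, s ≤ σ n s) → (∀ n t, t ≤ τ n t) →
    IsPolyTimeUnary₂ σ → IsPolyTimeUnary₂ τ →
    (∀ n, Monotone (σ n)) → (∀ s, Monotone fun n => σ n s) →
    (∀ n, Monotone (τ n)) → (∀ t, Monotone fun n => τ n t) →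
    (∃ A : RandAlg (List Bool × ℕ) (Option (List Bool)), U.SolvesGapMINKTSearch σ τ A) →
      U.gapMINKT σ τ ∈ PromiseZPP'

/-! ### The glue: Cor. 4.22 (1 ⇒ 4) from (1 ⇒ 2), Thm. 4.21 and Fact 3.8 -/

/-- **Cor. 4.22, (2 ⇒ 3 ⇒ 4) for explicit parameters.** From Thm. 4.21 and Fact 3.8: if
`(MINKT[n-1], 𝒟^KT) ∈ Avg_{1/6m}P` then `Gap_{σ,τ}MINKT ∈ PromiseZPP'` for `σ = sigmaBound c` and
`τ(n,t) = p(n+t)` for some `c, p` — passing from Thm. 4.21's `(σ,τ)` to the pointwise larger explicit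
bounds (`SolvesGapMINKTSearch.mono`), which are nondecreasing; their polynomial-time computability is
taken as hypotheses `hσ`, `hτ`. [cite: Hirahara2018, Cor. 4.22] -/
theorem gapMINKT_sigmaBound_mem_PromiseZPP'_of_AvgDeltaP
    (h421 : Hirahara2018_gapMINKTSearch_of_AvgDeltaP)
    (h38 : Hirahara2018_gapMINKT_mem_PromiseZPP_of_search)
    (hσ : ∀ c, IsPolyTimeUnary₂ (sigmaBound c))
    (hτ : ∀ p : Polynomial ℕ, IsPolyTimeUnary₂ fun n t => p.eval (n + t))
    (U : UniversalMachine)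
    (havg : (⟨U.MINKTr fun n => n - 1, DKT⟩ : DistProblem) ∈ AvgDeltaP (fun m => 1 / (6 * m))) :
    ∃ (c : ℕ) (p : Polynomial ℕ), (∀ n t, t ≤ p.eval (n + t)) ∧
      U.gapMINKT (sigmaBound c) (fun n t => p.eval (n + t)) ∈ PromiseZPP' := by
  have hr : ∃ n₀, ∀ n ≥ n₀, n ≤ (n - 1) + 1 * (Nat.sqrt n * Nat.log 2 n) ∧ n - 1 < n := by
    refine ⟨2, fun n hn => ⟨?_, by omega⟩⟩
    have h1 : 1 ≤ Nat.sqrt n := Nat.le_sqrt.2 (by omega)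
    have h2 : 1 ≤ Nat.log 2 n := Nat.le_log_of_pow_le (by norm_num) (by simpa using hn)
    have h3 : 1 ≤ Nat.sqrt n * Nat.log 2 n := Nat.one_le_iff_ne_zero.2 (Nat.mul_ne_zero (by omega) (by omega))
    omega
  obtain ⟨σ, τ, c, p, hσb, hτb, A, hA⟩ := h421 U (fun n => n - 1) 1 hr havg
  have hp : ∀ n t, t ≤ p.eval (n + t) := fun n t => (hτb n t).1.trans (hτb n t).2
  refine ⟨c, p, hp, h38 U (sigmaBound c) (fun n t => p.eval (n + t))
    (fun n s => by unfold sigmaBound; omega) hp (hσ c) (hτ p)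
    (monotone_sigmaBound_right c) (fun s => monotone_sigmaBound_left c s)
    (fun n t t' h => TM2Iter.eval_mono p (by omega)) (fun t n n' h => TM2Iter.eval_mono p (by omega))
    ⟨A, UniversalMachine.SolvesGapMINKTSearch.mono U (fun n s => (hσb n s).2) (fun n t => (hτb n t).2) hA⟩⟩

/-- **The glue of the layer: Cor. 4.22 (1 ⇒ 4)** from its printed steps — (1 ⇒ 2)
(`Hirahara2018_MINKTr_DKT_mem_AvgDeltaP`, `GapMINKTDenseRandom.lean`), (2 ⇒ 3) = Thm. 4.21 and
(3 ⇒ 4) = Fact 3.8 — modulo the polynomial-time computability of the explicit parameter bounds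
(`hσ`, `hτ`). With `Hirahara2018_gapMINKT_mem_PromiseP_of` (`GapMINKTProofs.lean`) this reduces
Cor. 4.23 to Buhrman–Fortnow–Pavan, Cor. 4.22 (1 ⇒ 2), Thm. 4.21 and Fact 3.8.
[cite: Hirahara2018, Cor. 4.22] -/
theorem Hirahara2018_gapMINKT_mem_PromiseZPP_of
    (h12 : Hirahara2018_MINKTr_DKT_mem_AvgDeltaP)
    (h421 : Hirahara2018_gapMINKTSearch_of_AvgDeltaP)
    (h38 : Hirahara2018_gapMINKT_mem_PromiseZPP_of_search)
    (hσ : ∀ c, IsPolyTimeUnary₂ (sigmaBound c))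
    (hτ : ∀ p : Polynomial ℕ, IsPolyTimeUnary₂ fun n t => p.eval (n + t)) :
    Hirahara2018_gapMINKT_mem_PromiseZPP := by
  intro U hD
  obtain ⟨c, p, hp, hmem⟩ :=
    gapMINKT_sigmaBound_mem_PromiseZPP'_of_AvgDeltaP h421 h38 hσ hτ U (h12 U hD)
  refine ⟨sigmaBound c, fun n t => p.eval (n + t), c, p, fun n s => ⟨?_, le_rfl⟩,
    fun n t => ⟨hp n t, le_rfl⟩, hmem⟩
  unfold sigmaBound
  omega

end Literature.Computability.MetaComplexity
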